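import Mathlib.Algebra.Module.CharacterModule
import Mathlib.RingTheory.Finiteness.Finsupp
import Mathlib.RingTheory.Noetherian.Basic
import HarnessLib

/-!
# Exactness of the character-module functor and finite generation of Pontryagin duals under
# extensions ("an extension of cofinitely generated modules is cofinitely generated")

Topic `Algebra/Module`; namespace `Literature.Algebra.Module`; THEOREMS ONLY.

Mathlib's `CharacterModule S = Hom(S, ℚ/ℤ)` with the induced `R`-structure `(r φ)(s) = φ(r s)` is
the tree's untopologised Pontryagin dual (`CharacterModuleCoNakayama.lean`, and the dictionary
`Greenberg2016.IsDualPairing`: "`S` is cofinitely generated" = "`S^∨` is a finitely generated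
`R`-module").  Mathlib proves that `(·)^∨` turns injections into surjections
(`CharacterModule.dual_surjective_of_injective`, Baer's criterion for the divisible group `ℚ/ℤ`) and
surjections into injections.  This file adds:

* `CharacterModule.exact_dual_rangeRestrict_dual_subtype` — exactness IN THE MIDDLE of
  `(im β)^∨ → T^∨ → (ker β)^∨` for any linear `β : T → H` (a character of `T` vanishing on `ker β`
  factors through `T ↠ im β`);
* `CharacterModule.module_finite_of_ker_of_range` — if `(ker β)^∨` and `(im β)^∨` are finitely
  generated then so is `T^∨` (Mathlib `Module.Finite.of_exact`); with the one-line inheritances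
  `CharacterModule.module_finite_of_injective_of_module_finite` (submodules) and
  `CharacterModule.module_finite_of_surjective_of_module_finite` (quotients, `R` Noetherian);
* `CharacterModule.module_finite_of_ker_le_range_of_map_le_range` — the form in which Greenberg
  uses it (proof of Prop. 3.2 of *On the structure of certain Galois cohomology groups*, p. 359
  L4–9: "the kernels of the two maps `Hⁱ(G,D) → Hⁱ(G,λD)`, `Hⁱ(G,λD) → Hⁱ(G,D)` are both
  [cofinitely generated] … and so the kernel of the composite map … `Hⁱ(G,D)[λ]` … is"): for a
  submodule `T ≤ Hn`, a linear `α : Hn → H₂` with `ker α ⊆ im u` and `α(T) ⊆ im w`, where `u : P → Hn`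
  and `w : Q → H₂` have finitely generated `P^∨`, `Q^∨`, the dual `T^∨` is finitely generated.

## References
* R. Greenberg, *On the structure of certain Galois cohomology groups*, Doc. Math. Extra Vol.
  Coates (2006) 335–391, §3 A, proof of Prop. 3.2 (p. 359 L4–9). [Greenberg2006]
-/

namespace Literature.Algebra.Module

open Function

section Exact

variable {R : Type*} [CommRing R] {T H : Type*} [AddCommGroup T] [Module R T] [AddCommGroup H]
  [Module R H]

/-- **Exactness of Pontryagin duality in the middle**: for a linear map `β : T → H`, a character
of `T` restricts to `0` on `ker β` iff it is the pull-back of a character of `im β` along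
`T ↠ im β` (the divisible group `ℚ/ℤ` is injective; here only the factorisation through the
surjection `T ↠ im β` is needed). [cite: Greenberg2006, §3 A (proof of Prop. 3.2, p. 359 L4–9)] -/
theorem CharacterModule.exact_dual_rangeRestrict_dual_subtype (β : T →ₗ[R] H) :
    Function.Exact (CharacterModule.dual (R := R) β.rangeRestrict)
      (CharacterModule.dual (R := R) (LinearMap.ker β).subtype) := by
  intro φ
  constructor
  · intro hφ
    -- `φ` kills `ker β = ker (T ↠ im β)`, hence factors through the surjection `T ↠ im β`
    set f : T →+ LinearMap.range β := β.rangeRestrict.toAddMonoidHom with hf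
    have hsurj : Function.Surjective f := LinearMap.surjective_rangeRestrict β
    have hker : f.ker ≤ (φ : T →+ AddCircle (1 : ℚ)).ker := by
      intro x hx
      rw [AddMonoidHom.mem_ker] at hx ⊢
      have hxβ : x ∈ LinearMap.ker β := by
        rw [LinearMap.mem_ker]
        have := congrArg Subtype.val hx
        simpa [hf] using this
      have := congrArg (fun ψ : CharacterModule (LinearMap.ker β) => ψ ⟨x, hxβ⟩) hφ
      exact this
    refine ⟨AddMonoidHom.liftOfRightInverse f (Function.surjInv hsurj)
      (Function.rightInverse_surjInv hsurj) ⟨φ, hker⟩, ?_⟩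
    ext x
    exact AddMonoidHom.liftOfRightInverse_comp_apply f (Function.surjInv hsurj)
      (Function.rightInverse_surjInv hsurj) ⟨φ, hker⟩ x
  · rintro ⟨ψ, rfl⟩
    ext ⟨x, hx⟩
    have h0 : β.rangeRestrict x = 0 := Subtype.ext (by simpa using hx)
    change ψ (β.rangeRestrict x) = 0
    rw [h0, map_zero]

/-- **An extension of modules with finitely generated duals has finitely generated dual**: if
`(ker β)^∨` and `(im β)^∨` are finitely generated `R`-modules, so is `T^∨` (exact sequence
`(im β)^∨ → T^∨ → (ker β)^∨ → 0`, Mathlib `Module.Finite.of_exact`).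
[cite: Greenberg2006, §3 A (proof of Prop. 3.2, p. 359 L4–9)] -/
theorem CharacterModule.module_finite_of_ker_of_range (β : T →ₗ[R] H)
    [Module.Finite R (CharacterModule (LinearMap.ker β))]
    [Module.Finite R (CharacterModule (LinearMap.range β))] :
    Module.Finite R (CharacterModule T) :=
  Module.Finite.of_exact (CharacterModule.exact_dual_rangeRestrict_dual_subtype β)
    (CharacterModule.dual_surjective_of_injective _ (LinearMap.ker β).injective_subtype)

/-- A submodule (the source of an injective linear map) of a module with finitely generated dual
has finitely generated dual: `T^∨` is a quotient of `H^∨`.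
[cite: Greenberg2006, §3 A (p. 358 L35–36 "`H⁰(G, D) = D^G` is just an `R`-submodule of `D`, and so is also a cofinitely generated `R`-module")] -/
theorem CharacterModule.module_finite_of_injective_of_module_finite (f : T →ₗ[R] H)
    (hf : Function.Injective f) [Module.Finite R (CharacterModule H)] :
    Module.Finite R (CharacterModule T) :=
  Module.Finite.of_surjective (CharacterModule.dual f)
    (CharacterModule.dual_surjective_of_injective f hf)

/-- A quotient (the target of a surjective linear map) of a module with finitely generated dual has
finitely generated dual, over a Noetherian ring: `T^∨` is a submodule of `H^∨`.
[cite: Greenberg2006, §3 A (proof of Prop. 3.2, p. 359 L4–9)] -/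
theorem CharacterModule.module_finite_of_surjective_of_module_finite [IsNoetherianRing R]
    (f : H →ₗ[R] T) (hf : Function.Surjective f) [Module.Finite R (CharacterModule H)] :
    Module.Finite R (CharacterModule T) :=
  Module.Finite.of_injective (CharacterModule.dual f)
    (CharacterModule.dual_injective_of_surjective f hf)

end Exact

section Greenberg

variable {R : Type*} [CommRing R] [IsNoetherianRing R]
variable {Hn H₂ P Q : Type*} [AddCommGroup Hn] [Module R Hn] [AddCommGroup H₂] [Module R H₂]
  [AddCommGroup P] [Module R P] [AddCommGroup Q] [Module R Q]

/-- **The kernel-of-the-composite step of Greenberg's Prop. 3.2, as pure algebra.** Let `T ≤ Hn`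
be a submodule, `α : Hn → H₂` linear with `ker α ⊆ im u` and `α(T) ⊆ im w` for linear maps
`u : P → Hn`, `w : Q → H₂` whose sources have finitely generated Pontryagin duals, `R` Noetherian.
Then `T^∨` is finitely generated: `ker (α|T) ↪ im u` and `im (α|T) ↪ im w` have finitely generated
duals (quotients of submodules of `P^∨`, `Q^∨`), and `T` is an extension of the two. In print:
`Hn = Hⁱ(G,D)`, `α = Hⁱ(D → λD)`, `u = Hⁱ(D[λ] → D)`, `w = ∂ : Hⁱ⁻¹(G, D/λD) → Hⁱ(G, λD)`,
`T = Hⁱ(G,D)[λ]`. [cite: Greenberg2006, §3 A (proof of Prop. 3.2, p. 359 L4–9)] -/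
theorem CharacterModule.module_finite_of_ker_le_range_of_map_le_range (T : Submodule R Hn)
    (α : Hn →ₗ[R] H₂) (u : P →ₗ[R] Hn) (w : Q →ₗ[R] H₂)
    (hker : LinearMap.ker α ≤ LinearMap.range u) (hT : T.map α ≤ LinearMap.range w)
    [Module.Finite R (CharacterModule P)] [Module.Finite R (CharacterModule Q)] :
    Module.Finite R (CharacterModule T) := by
  haveI : Module.Finite R (CharacterModule (LinearMap.range u)) :=
    CharacterModule.module_finite_of_surjective_of_module_finite u.rangeRestrict
      (LinearMap.surjective_rangeRestrict u)
  haveI : Module.Finite R (CharacterModule (LinearMap.range w)) :=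
    CharacterModule.module_finite_of_surjective_of_module_finite w.rangeRestrict
      (LinearMap.surjective_rangeRestrict w)
  set β : T →ₗ[R] H₂ := α.domRestrict T with hβ
  -- `ker β ↪ im u`
  have hmem : ∀ x : LinearMap.ker β, ((x : T) : Hn) ∈ LinearMap.range u := fun x => by
    apply hker
    rw [LinearMap.mem_ker]
    have hx := x.2
    rw [LinearMap.mem_ker] at hx
    exact hx
  let e : LinearMap.ker β →ₗ[R] LinearMap.range u :=
    LinearMap.codRestrict (LinearMap.range u) (T.subtype.comp (LinearMap.ker β).subtype) hmem
  have he : Function.Injective e := by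
    intro x y hxy
    apply Subtype.ext
    apply Subtype.ext
    exact congrArg (fun z : LinearMap.range u => (z : Hn)) hxy
  haveI : Module.Finite R (CharacterModule (LinearMap.ker β)) :=
    CharacterModule.module_finite_of_injective_of_module_finite e he
  -- `im β ↪ im w`
  have hrange : LinearMap.range β ≤ LinearMap.range w := by
    rintro y ⟨x, rfl⟩
    exact hT ⟨x, x.2, rfl⟩
  haveI : Module.Finite R (CharacterModule (LinearMap.range β)) :=
    CharacterModule.module_finite_of_injective_of_module_finite (Submodule.inclusion hrange)
      (Submodule.inclusion_injective hrange)
  exact CharacterModule.module_finite_of_ker_of_range β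

end Greenberg

end Literature.Algebra.Module
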